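import Summits.NavierStokesRegularity.NavierStokesRegularity.Theorems.ExtremiserTransiencePinnedDepletionByName
import HarnessLib

/-!
# Crux `NearExtremalTransiencePerFlow` (stmt-NavierStokesRegularity-26567), LINES g13-α `budget_cut` / g13-β `relay`:
# EVERY PER-VIOLATOR STATEMENT OF THE TWO LINES IS EQUIVALENT TO THE CRUX (kernel bookkeeping for the custody record)

Theorems file (`--supports stmt-NavierStokesRegularity-26567`, helper; prover seat ns-net-p1 g17).  The statements of the g13 lines
(texts of record `…Theorems.ExtremiserTransiencePinnedDepletionDefs`) are all typed PER VIOLATOR (`∀ C ν T u p, IsViolator C ν T u p → …`),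
and `IsViolator` is literally «all hypotheses of the crux and the negation of its per-flow conclusion».  Hence the crux implies that
there is NO violator (`not_isViolator_of_nearExtremalTransiencePerFlow`), so every per-violator statement follows from the crux
vacuously; combined with the landed sandwiches and cuts this gives the EQUIVALENCES

* `pinnedDepletedFraction_iff : PinnedDepletedFraction ↔ NearExtremalTransiencePerFlow` (the junction `C′`),
* `cellRelayDecomposition_iff : CellRelayDecomposition ↔ NearExtremalTransiencePerFlow` (the relay heart D♭ ALONE is the crux),
* `smallBudget_and_crowd_iff : (SmallBudgetDepletion ∧ CrowdDepletion) ↔ NearExtremalTransiencePerFlow` (g13-α),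
* and the one-way weakenings `SmallBudgetDepletion.of_nearExtremalTransiencePerFlow`, `CrowdDepletion.of_nearExtremalTransiencePerFlow`.

READING (honest, for the re-opening hand and the planners): the per-violator repair that rescued X♭ from the g13 counterexample scheme
makes the junction and each heart a REFORMULATION of the crux (equivalent in the kernel), not a strict cut; the flank K♭ and the heart
C♭ are each individually WEAKER than the crux (implied by it) and only jointly equivalent — so a proof of K♭ alone is genuine partial
progress while a proof of C′, D♭ or K♭ ∧ C♭ is a proof of the crux itself.  HONEST FRAMING: bookkeeping only; K♭, C♭, D♭, C′, the
crux ⟨26567⟩ and NS regularity are OPEN; nothing about Navier–Stokes regularity or blow-up is proved; no summit is proved by a line.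
[folklore]
-/

noncomputable section

open scoped Topology InnerProductSpace RealInnerProductSpace ENNReal ContDiff
open MeasureTheory Filter Set Metric
open Literature.Analysis.FluidPDE
open Summit.NavierStokesRegularity.NavierStokesRegularity.Theses.ExtremiserTransience
open Summit.NavierStokesRegularity.NavierStokesRegularity.Theorems
open Summit.NavierStokesRegularity.NavierStokesRegularity.Theorems.DepletionLadder.KStar.HalfSpace
open Summit.NavierStokesRegularity.NavierStokesRegularity.Theorems.NearExtremalTransiencePerFlow.ZoneTransversality
open Summit.NavierStokesRegularity.NavierStokesRegularity.Theorems.NearExtremalTransiencePerFlow.DepletedFraction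

namespace Summit.NavierStokesRegularity.NavierStokesRegularity.Theorems.NearExtremalTransiencePerFlow.PinnedDepletion

-- the summit's namespace repeats the problem name by convention (D-0017)
set_option linter.dupNamespace false

/-- **Under the crux there is no violator**: `IsViolator C ν T u p` packages the hypotheses of `NearExtremalTransiencePerFlow` together
with the negation of its per-flow conclusion `PFC T u`. [folklore] -/
theorem not_isViolator_of_nearExtremalTransiencePerFlow (h : NearExtremalTransiencePerFlow) (C ν T : ℝ)
    (u : ℝ → EuclideanSpace ℝ (Fin 3) → EuclideanSpace ℝ (Fin 3)) (p : ℝ → EuclideanSpace ℝ (Fin 3) → ℝ) :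
    ¬ IsViolator C ν T u p := by
  rintro ⟨hC, hν, hT, hsol, hLH, hdec, hrate, hsing, hno⟩
  exact hno (h C ν T hC hν hT u p hsol hLH hdec hrate hsing)

/-- The crux implies the junction `C′` (vacuously: no violator). [folklore] -/
theorem PinnedDepletedFraction.of_nearExtremalTransiencePerFlow (h : NearExtremalTransiencePerFlow) : PinnedDepletedFraction :=
  fun C ν T u p hV => absurd hV (not_isViolator_of_nearExtremalTransiencePerFlow h C ν T u p)

/-- The crux implies K♭ (vacuously). [folklore] -/
theorem SmallBudgetDepletion.of_nearExtremalTransiencePerFlow (h : NearExtremalTransiencePerFlow) : SmallBudgetDepletion :=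
  fun C ν T u p hV => absurd hV (not_isViolator_of_nearExtremalTransiencePerFlow h C ν T u p)

/-- The crux implies C♭ (vacuously). [folklore] -/
theorem CrowdDepletion.of_nearExtremalTransiencePerFlow (h : NearExtremalTransiencePerFlow) : CrowdDepletion :=
  fun C ν T u p hV => absurd hV (not_isViolator_of_nearExtremalTransiencePerFlow h C ν T u p)

/-- The crux implies D♭ (vacuously). [folklore] -/
theorem CellRelayDecomposition.of_nearExtremalTransiencePerFlow (h : NearExtremalTransiencePerFlow) : CellRelayDecomposition :=
  fun C ν T u p hV => absurd hV (not_isViolator_of_nearExtremalTransiencePerFlow h C ν T u p)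

/-- **The junction IS the crux**: `PinnedDepletedFraction ↔ NearExtremalTransiencePerFlow` (⇒ the pinned sandwich through W♭⁺;
⇐ vacuous). [folklore] -/
theorem pinnedDepletedFraction_iff : PinnedDepletedFraction ↔ NearExtremalTransiencePerFlow :=
  ⟨nearExtremalTransiencePerFlow_of_pinned, PinnedDepletedFraction.of_nearExtremalTransiencePerFlow⟩

/-- **The relay heart IS the crux**: `CellRelayDecomposition ↔ NearExtremalTransiencePerFlow` (⇒ relay cut with R♭ proved, then the
sandwich; ⇐ vacuous). [folklore] -/
theorem cellRelayDecomposition_iff : CellRelayDecomposition ↔ NearExtremalTransiencePerFlow :=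
  ⟨nearExtremalTransiencePerFlow_of_cellRelayDecomposition', CellRelayDecomposition.of_nearExtremalTransiencePerFlow⟩

/-- **The budget cut IS the crux**: `SmallBudgetDepletion ∧ CrowdDepletion ↔ NearExtremalTransiencePerFlow` (each conjunct alone is
implied by the crux; jointly they imply it). [folklore] -/
theorem smallBudget_and_crowd_iff : (SmallBudgetDepletion ∧ CrowdDepletion) ↔ NearExtremalTransiencePerFlow :=
  ⟨fun h => nearExtremalTransiencePerFlow_of_budgetCut' h.1 h.2,
    fun h => ⟨SmallBudgetDepletion.of_nearExtremalTransiencePerFlow h, CrowdDepletion.of_nearExtremalTransiencePerFlow h⟩⟩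

/-- Given the flank K♭, the heart C♭ IS the crux: `SmallBudgetDepletion → (CrowdDepletion ↔ NearExtremalTransiencePerFlow)`. [folklore] -/
theorem crowdDepletion_iff_of_smallBudget (hK : SmallBudgetDepletion) : CrowdDepletion ↔ NearExtremalTransiencePerFlow :=
  ⟨fun hC => nearExtremalTransiencePerFlow_of_budgetCut' hK hC, CrowdDepletion.of_nearExtremalTransiencePerFlow⟩

end Summit.NavierStokesRegularity.NavierStokesRegularity.Theorems.NearExtremalTransiencePerFlow.PinnedDepletion

end
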